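import Summits.BirchSwinnertonDyer.Rank1Residual.Additive.GordRatMainConjLowerBoundOdd
import Summits.BirchSwinnertonDyer.Rank1Residual.Additive.PotMultRatMainConjLowerBound
import Summits.BirchSwinnertonDyer.Rank1Residual.Additive.PotMultRatMainConjLowerBoundOdd
import HarnessLib

/-!
# Class X3 (reducible `E[p]`) on the semistable-twist locus, analytic rank `0`: the LOWER half and
# `BSD(E,p)` from the RATIONAL `χ_p`-branch main conjecture of the twist plus ONE `μ`-certificate —
# with NO image hypothesis (cell `b2b-bsdres`, team n1011, seat n1011-p06, OWNERS row T-N10R, phase 5)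

HONEST FRAMING (cell `b2b-bsdres`, run/shared/lean/b2b/bsd-rank1-residual/, verbatim in every
file): the goal of the cell is to DELETE the COMBINATION-SHAPED residual classes of the
Birch–Swinnerton-Dyer formula for ALL analytic-rank `≤ 1` elliptic curves over `ℚ` — "full BSD
formula for every rank `≤ 1` curve in class `C`" assembled STRICTLY from published theorems — so
that the rank-`≤ 1` remainder becomes exactly the CONSTRUCTION-SHAPED classes, which are TYPED
(missing-input `Prop`s), NOT attempted. This is not "finishing BSD". Team n1011 (§I items N10 / N11):
research routes; prove what is provable now; no claim beyond the stated classes; X3♯(M) / X3♯(G-ord)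
stay CONSTRUCTION-SHAPED; labels / census / located gap UNCHANGED; nothing is booked. Theorems only;
no definition, no named fact.

## What and why

The kernel steps of phases 1–3 (`cycLowerLeadingTermAt_of_chiBranchRatCharEq{,Odd,Mult,MultOdd}_of_unitCoeff`)
carry NO image hypothesis: they turn the typed RATIONAL `ω^{(p−1)/2}`-branch main conjecture of the
semistable twist `E♭` plus ONE unit coefficient of the Néron-normalised branch series into the
integral `T = 0` divisibility `CycLowerLeadingTermAt W p`. N10's OTHER family is X3 (additive `p`,
`E[p]` REDUCIBLE; r = 0 cells of record 21 169, RESIDUAL-MAP §I N10); this file records the X3 class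
forms on the two semistable-twist loci:

* X3♯(G-ord) ∩ `I₀*` (`ClassX3Gord W p ∧ semistabilityIndex W p = 2`): `CycLowerLeadingTermAt`
  (even / odd `p`), the LOWER half `MissingLowerBoundAt W p` on the non-anomalous rows at `p ≥ 5`
  (additive-p2's core + Delbourgo 2002, `hDel`), and **`BSD(E,p)` with the UPPER half from WUTHRICH's
  reducible divisibility** (`ClassX3Gord.missingUpperBoundAt_rankZero_of_wuthrichHalf`, `hWu` =
  Wuthrich 2014 Thm. 16 half-eigen form; Delbourgo 1998 Prop. 4 `hDel98`) — no surjectivity anywhere.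
* X3♯(M) (`AdditivePotMult.ClassX3M W p`): `CycLowerLeadingTermAt`, the LOWER half through n1011-p18's
  exact-(M) consumer `ClassX3M.missingLowerBoundAt_rankZero_of_cycLeadingTermDvd` (`hDelX`; every odd
  `p`, `3` included), and `BSD(E,p)` with additive-p1's `ClassX3M.bsdp_rankZero_of_lower` (Wuthrich
  Thm. 16 half-eigen `hW16`; any odd `p`).

Located gap unchanged: the Eisenstein divisibility of the branch main conjecture, rationally (typed
`ChiBranchRatCharEq{,Odd,Mult,MultOdd}At`); the certificate is per-pair EVIDENCE
(`cells/n1011/PREDICTIONS-Q6.md`, whose universe is X4 — the X3 rows are a later register). Nothing booked.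

References: Burungale–Castella–Skinner, IMRN 2025 Thm. 1.1.2 (a) [BurungaleCastellaSkinner2025];
Wuthrich, Doc. Math. 19 (2014) Thm. 16 [Wuthrich2014]; Delbourgo, Compositio Math. 113 (1998) Prop. 4
[Delbourgo1998]; Delbourgo, J. Number Theory 95 (2002) Thm. (A), (B) [Delbourgo2002];
Mazur–Tate–Teitelbaum, Invent. Math. 84 (1986) §I.13–I.14 [MazurTateTeitelbaum1986Invent]; Pal, Proc.
AMS (2012) Thm. 3.2 [Pal2012]; Miller, LMS J. Comput. Math. 14 (2011) Def. 1.1 [Miller2011LMS].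
-/

noncomputable section

open scoped Classical MatrixGroups ModularForm NumberField

open CongruenceSubgroup WeierstrassCurve NumberField Literature.NumberTheory.EllipticCurves
  Literature.NumberTheory.EllipticCurves.ModularForms
  Literature.NumberTheory.EllipticCurves.Rank1Residual
  Literature.NumberTheory.EllipticCurves.Rank1Residual.Typed
  IsDedekindDomain

namespace Summit.BirchSwinnertonDyer.Rank1Residual.Additive

variable {W : WeierstrassCurve ℚ} [W.IsElliptic] [W.IsGloballyMinimal] {p : ℕ} [hp : Fact p.Prime]

/-! ### §1 X3♯(G-ord) ∩ `I₀*` -/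

/-- **X3♯(G-ord) ∩ `I₀*`, `p ≡ 1 (mod 4)`: `CycLowerLeadingTermAt W p` from the rational branch main
conjecture of the good-ordinary twist and the certificate** (twist model
`ClassX3Gord.exists_goodOrd_pStar_twist_model`; kernel `cycLowerLeadingTermAt_of_chiBranchRatCharEq_of_unitCoeff`).
[cite: MazurTateTeitelbaum1986Invent, §I.14] [cite: Pal2012, Thm. 3.2] -/
theorem ClassX3Gord.cycLowerLeadingTermAt_of_ratCharEq_of_unitCoeff
    (hPal : Pal2012.thm32_sqrt_mul_realPeriodRat_twist_eq_of_prime_one_mod_four)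
    (hmod : hasEntireLFunction_rat) (hmodD : nonempty_modularParametrizationData)
    (hX : ClassX3Gord W p) (he : semistabilityIndex W p = 2) (hp4 : p % 4 = 1)
    (hMC : ChiBranchRatCharEqAt W p)
    (hcert : ∀ (V : WeierstrassCurve ℚ) [V.IsElliptic] [V.IsGloballyMinimal] (C : VariableChange ℚ),
      GoodOrd V p → C • V.quadraticTwist (p : ℚ) = W →
      ∀ {N : ℕ} [NeZero N] (f : CuspForm (Gamma0 N) 2), IsNewformOf V f →
      ∀ ϖ : ℚ, (ϖ : ℝ) * V.realPeriodRat = plusPeriod f →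
      ∃ n : ℕ, ‖PowerSeries.coeff n
        (PowerSeries.C (ϖ : ℚ_[p]) * padicLFunctionBranch f (unitRoot V p : ℚ_[p]) (p / 2))‖ = 1) :
    CycLowerLeadingTermAt W p := by
  have hp2 : p ≠ 2 := by omega
  obtain ⟨V, iV, iVm, C, hV, hC⟩ := hX.exists_goodOrd_pStar_twist_model W p hp2 he
  haveI : NeZero (V.conductorNorm ℤ) := ⟨(V.conductorNorm_pos_holds).ne'⟩
  obtain ⟨Dm⟩ := hmodD V
  obtain ⟨ϖ, -, hϖ, -⟩ := Dm.exists_rat_mul_realPeriodRat_eq_plusPeriod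
  have hC' : C • V.quadraticTwist (p : ℚ) = W := by
    rw [pStar_eq_of_mod_four p (Or.inl hp4), if_pos hp4] at hC
    exact hC
  exact cycLowerLeadingTermAt_of_chiBranchRatCharEq_of_unitCoeff W p hPal hmod hp4 hX.addv V ⟨C, hC'⟩
    hV Dm.isNewformOf ϖ hϖ hMC (hcert V C hV hC' Dm.f Dm.isNewformOf ϖ hϖ)

/-- **X3♯(G-ord) ∩ `I₀*`, `p ≡ 3 (mod 4)` (`p = 3` included): `CycLowerLeadingTermAt W p` from the
rational ODD branch main conjecture and the certificate.** [cite: MazurTateTeitelbaum1986Invent, §I.14] -/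
theorem ClassX3Gord.cycLowerLeadingTermAt_of_ratCharEqOdd_of_unitCoeff
    (hmod : hasEntireLFunction_rat) (hmodD : nonempty_modularParametrizationData)
    (hX : ClassX3Gord W p) (he : semistabilityIndex W p = 2) (hp4 : p % 4 = 3)
    (hMC : ChiBranchRatCharEqOddAt W p)
    (hcert : ∀ (V : WeierstrassCurve ℚ) [V.IsElliptic] [V.IsGloballyMinimal] (C : VariableChange ℚ),
      GoodOrd V p → C • V.quadraticTwist (-(p : ℚ)) = W →
      ∀ {N : ℕ} [NeZero N] (f : CuspForm (Gamma0 N) 2), IsNewformOf V f →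
      ∀ ϖ : ℚ, (ϖ : ℝ) * V.imaginaryPeriodRat = minusPeriod f →
      ∃ n : ℕ, ‖PowerSeries.coeff n
        (PowerSeries.C (ϖ : ℚ_[p]) * padicLFunctionMinusBranch f (unitRoot V p : ℚ_[p]) (p / 2))‖ = 1) :
    CycLowerLeadingTermAt W p := by
  have hp2 : p ≠ 2 := by omega
  obtain ⟨V, iV, iVm, C, hV, hC⟩ := hX.exists_goodOrd_pStar_twist_model W p hp2 he
  haveI : NeZero (V.conductorNorm ℤ) := ⟨(V.conductorNorm_pos_holds).ne'⟩
  obtain ⟨Dm⟩ := hmodD V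
  obtain ⟨ϖ, -, hϖ⟩ := exists_rat_mul_imaginaryPeriodRat_eq_minusPeriod Dm
  have hC' : C • V.quadraticTwist (-(p : ℚ)) = W := by
    rw [pStar_eq_of_mod_four p (Or.inr hp4), if_neg (by omega)] at hC
    exact hC
  exact cycLowerLeadingTermAt_of_chiBranchRatCharEqOdd_of_unitCoeff W p hmod hp4 hX.addv V C hC' hV
    Dm.isNewformOf ϖ hϖ hMC (hcert V C hV hC' Dm.f Dm.isNewformOf ϖ hϖ)

/-- **X3♯(G-ord) ∩ `I₀*` ∩ non-anomalous, `p ≥ 5`, `p ≡ 1 (mod 4)`, `E` non-CM, `r_an = 0`: the LOWER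
half** (additive-p2's `exists_padicVal_shaAn_of_cycLowerLeadingTerm` + Delbourgo 2002 `hDel`).
X3♯(G-ord) stays CONSTRUCTION-SHAPED. [cite: Delbourgo2002, Theorem (A), (B) (p. 40)] -/
theorem ClassX3Gord.missingLowerBoundAt_rankZero_of_ratCharEq_of_unitCoeff
    (hDel : Delbourgo2002.mainTheorem)
    (hPal : Pal2012.thm32_sqrt_mul_realPeriodRat_twist_eq_of_prime_one_mod_four)
    (hGZK : rank_eq_analyticRank_of_analyticRank_le_one) (hmod : hasEntireLFunction_rat)
    (hmodD : nonempty_modularParametrizationData)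
    (hX : ClassX3Gord W p) (he : semistabilityIndex W p = 2) (hp5 : 5 ≤ p) (hp4 : p % 4 = 1)
    (hcm : ¬ W.HasCM) (hr : W.analyticRank = 0) (hna : Delbourgo2002.ReductionNonAnomalous W p)
    (hMC : ChiBranchRatCharEqAt W p)
    (hcert : ∀ (V : WeierstrassCurve ℚ) [V.IsElliptic] [V.IsGloballyMinimal] (C : VariableChange ℚ),
      GoodOrd V p → C • V.quadraticTwist (p : ℚ) = W →
      ∀ {N : ℕ} [NeZero N] (f : CuspForm (Gamma0 N) 2), IsNewformOf V f →
      ∀ ϖ : ℚ, (ϖ : ℝ) * V.realPeriodRat = plusPeriod f →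
      ∃ n : ℕ, ‖PowerSeries.coeff n
        (PowerSeries.C (ϖ : ℚ_[p]) * padicLFunctionBranch f (unitRoot V p : ℚ_[p]) (p / 2))‖ = 1) :
    MissingLowerBoundAt W p := by
  have hLow := ClassX3Gord.cycLowerLeadingTermAt_of_ratCharEq_of_unitCoeff hPal hmod hmodD hX he
    hp4 hMC hcert
  obtain ⟨q, hq, -, c, ℓ, -, -, hℓ1, hval⟩ :=
    exists_padicVal_shaAn_of_cycLowerLeadingTerm W p hDel hGZK hmod hp5 hcm hX.addv hX.typeGOrd hr hLow
  refine ⟨q, hq, ?_⟩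
  have hc : 0 ≤ ((c : ℤ_[p]) : ℚ_[p]).valuation := PadicInt.valuation_coe_nonneg
  rw [hℓ1 hna, padicValNat_one_right, Nat.cast_zero, add_zero] at hval
  linarith

/-- **X3♯(G-ord) ∩ `I₀*` ∩ non-anomalous, `p ≥ 5`, `p ≡ 3 (mod 4)`, `E` non-CM, `r_an = 0`: the LOWER
half from the rational ODD branch main conjecture.** [cite: Delbourgo2002, Theorem (A), (B) (p. 40)] -/
theorem ClassX3Gord.missingLowerBoundAt_rankZero_of_ratCharEqOdd_of_unitCoeff
    (hDel : Delbourgo2002.mainTheorem)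
    (hGZK : rank_eq_analyticRank_of_analyticRank_le_one) (hmod : hasEntireLFunction_rat)
    (hmodD : nonempty_modularParametrizationData)
    (hX : ClassX3Gord W p) (he : semistabilityIndex W p = 2) (hp5 : 5 ≤ p) (hp4 : p % 4 = 3)
    (hcm : ¬ W.HasCM) (hr : W.analyticRank = 0) (hna : Delbourgo2002.ReductionNonAnomalous W p)
    (hMC : ChiBranchRatCharEqOddAt W p)
    (hcert : ∀ (V : WeierstrassCurve ℚ) [V.IsElliptic] [V.IsGloballyMinimal] (C : VariableChange ℚ),
      GoodOrd V p → C • V.quadraticTwist (-(p : ℚ)) = W →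
      ∀ {N : ℕ} [NeZero N] (f : CuspForm (Gamma0 N) 2), IsNewformOf V f →
      ∀ ϖ : ℚ, (ϖ : ℝ) * V.imaginaryPeriodRat = minusPeriod f →
      ∃ n : ℕ, ‖PowerSeries.coeff n
        (PowerSeries.C (ϖ : ℚ_[p]) * padicLFunctionMinusBranch f (unitRoot V p : ℚ_[p]) (p / 2))‖ = 1) :
    MissingLowerBoundAt W p := by
  have hLow := ClassX3Gord.cycLowerLeadingTermAt_of_ratCharEqOdd_of_unitCoeff hmod hmodD hX he hp4 hMC
    hcert
  obtain ⟨q, hq, -, c, ℓ, -, -, hℓ1, hval⟩ :=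
    exists_padicVal_shaAn_of_cycLowerLeadingTerm W p hDel hGZK hmod hp5 hcm hX.addv hX.typeGOrd hr hLow
  refine ⟨q, hq, ?_⟩
  have hc : 0 ≤ ((c : ℤ_[p]) : ℚ_[p]).valuation := PadicInt.valuation_coe_nonneg
  rw [hℓ1 hna, padicValNat_one_right, Nat.cast_zero, add_zero] at hval
  linarith

/-- **X3♯(G-ord) ∩ `I₀*` ∩ non-anomalous, `p ≥ 5`, `p ≡ 1 (mod 4)`, `E` non-CM, `r_an = 0`: `BSD(E,p)`
from the rational branch main conjecture + certificate, the UPPER half being WUTHRICH's reducible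
divisibility** (`ClassX3Gord.missingUpperBoundAt_rankZero_of_wuthrichHalf`: Wuthrich 2014 Thm. 16
half-eigen form `hWu` + Delbourgo 1998 Prop. 4 `hDel98`) — NO image hypothesis at all. Nothing booked.
[cite: Wuthrich2014, Thm. 16 (p. 397)] [cite: Delbourgo2002, Theorem (A), (B) (p. 40)] [cite: Miller2011LMS, Def. 1.1] -/
theorem ClassX3Gord.bsdp_rankZero_of_ratCharEq_of_unitCoeff_of_wuthrichHalf
    (hDel : Delbourgo2002.mainTheorem)
    (hWu : Wuthrich2014.thm16_halfEigenCharIdeal_dvd_cyclotomicPrime)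
    (hDel98 : Delbourgo1998.prop4_rankZero_pow_dvd_constantCoeff)
    (hPal : Pal2012.thm32_sqrt_mul_realPeriodRat_twist_eq_of_prime_one_mod_four)
    (hGZK : rank_eq_analyticRank_of_analyticRank_le_one) (hmod : hasEntireLFunction_rat)
    (hmodD : nonempty_modularParametrizationData)
    (hX : ClassX3Gord W p) (he : semistabilityIndex W p = 2) (hp5 : 5 ≤ p) (hp4 : p % 4 = 1)
    (hcm : ¬ W.HasCM) (hr : W.analyticRank = 0) (hna : Delbourgo2002.ReductionNonAnomalous W p)
    (hMC : ChiBranchRatCharEqAt W p)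
    (hcert : ∀ (V : WeierstrassCurve ℚ) [V.IsElliptic] [V.IsGloballyMinimal] (C : VariableChange ℚ),
      GoodOrd V p → C • V.quadraticTwist (p : ℚ) = W →
      ∀ {N : ℕ} [NeZero N] (f : CuspForm (Gamma0 N) 2), IsNewformOf V f →
      ∀ ϖ : ℚ, (ϖ : ℝ) * V.realPeriodRat = plusPeriod f →
      ∃ n : ℕ, ‖PowerSeries.coeff n
        (PowerSeries.C (ϖ : ℚ_[p]) * padicLFunctionBranch f (unitRoot V p : ℚ_[p]) (p / 2))‖ = 1) :
    BSDp W p :=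
  bsdp_of_missingPPartAt W p hGZK (by rw [hr]; exact zero_le_one)
    (missingPPartAt_of_lower_of_upper W p
      (ClassX3Gord.missingLowerBoundAt_rankZero_of_ratCharEq_of_unitCoeff hDel hPal hGZK hmod hmodD hX
        he hp5 hp4 hcm hr hna hMC hcert)
      (ClassX3Gord.missingUpperBoundAt_rankZero_of_wuthrichHalf hWu hDel98 hGZK hmod hmodD
        (by omega) hX he hr))

/-- **X3♯(G-ord) ∩ `I₀*` ∩ non-anomalous, `p ≥ 5`, `p ≡ 3 (mod 4)`, `E` non-CM, `r_an = 0`: `BSD(E,p)`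
from the rational ODD branch main conjecture + certificate and Wuthrich's upper half.** Nothing booked.
[cite: Wuthrich2014, Thm. 16 (p. 397)] [cite: Delbourgo2002, Theorem (A), (B) (p. 40)] [cite: Miller2011LMS, Def. 1.1] -/
theorem ClassX3Gord.bsdp_rankZero_of_ratCharEqOdd_of_unitCoeff_of_wuthrichHalf
    (hDel : Delbourgo2002.mainTheorem)
    (hWu : Wuthrich2014.thm16_halfEigenCharIdeal_dvd_cyclotomicPrime)
    (hDel98 : Delbourgo1998.prop4_rankZero_pow_dvd_constantCoeff)
    (hGZK : rank_eq_analyticRank_of_analyticRank_le_one) (hmod : hasEntireLFunction_rat)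
    (hmodD : nonempty_modularParametrizationData)
    (hX : ClassX3Gord W p) (he : semistabilityIndex W p = 2) (hp5 : 5 ≤ p) (hp4 : p % 4 = 3)
    (hcm : ¬ W.HasCM) (hr : W.analyticRank = 0) (hna : Delbourgo2002.ReductionNonAnomalous W p)
    (hMC : ChiBranchRatCharEqOddAt W p)
    (hcert : ∀ (V : WeierstrassCurve ℚ) [V.IsElliptic] [V.IsGloballyMinimal] (C : VariableChange ℚ),
      GoodOrd V p → C • V.quadraticTwist (-(p : ℚ)) = W →
      ∀ {N : ℕ} [NeZero N] (f : CuspForm (Gamma0 N) 2), IsNewformOf V f →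
      ∀ ϖ : ℚ, (ϖ : ℝ) * V.imaginaryPeriodRat = minusPeriod f →
      ∃ n : ℕ, ‖PowerSeries.coeff n
        (PowerSeries.C (ϖ : ℚ_[p]) * padicLFunctionMinusBranch f (unitRoot V p : ℚ_[p]) (p / 2))‖ = 1) :
    BSDp W p :=
  bsdp_of_missingPPartAt W p hGZK (by rw [hr]; exact zero_le_one)
    (missingPPartAt_of_lower_of_upper W p
      (ClassX3Gord.missingLowerBoundAt_rankZero_of_ratCharEqOdd_of_unitCoeff hDel hGZK hmod hmodD hX he
        hp5 hp4 hcm hr hna hMC hcert)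
      (ClassX3Gord.missingUpperBoundAt_rankZero_of_wuthrichHalf hWu hDel98 hGZK hmod hmodD
        (by omega) hX he hr))

/-! ### §2 X3♯(M) -/

/-- **X3♯(M), `p ≡ 1 (mod 4)`, `r_an = 0`: the LOWER half from the rational branch main conjecture of
the MULTIPLICATIVE twist and the certificate** — kernel `cycLowerLeadingTermAt_of_chiBranchRatCharEqMult_of_unitCoeff`,
bridge `cycLeadingTermDvdAt_of_cycLowerLeadingTermAt`, n1011-p18's exact-(M) consumer
`ClassX3M.missingLowerBoundAt_rankZero_of_cycLeadingTermDvd` (Delbourgo 1998 Prop. 4 + §2.2 Lemma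
(ii), `hDelX`). Every odd `p ≡ 1 (mod 4)`; no image / anomalous / `p ≥ 5` hypothesis.
[cite: Delbourgo1998, Prop. 4 (p. 144), §2.2 Lemma (ii) (p. 139)] [cite: MazurTateTeitelbaum1986Invent, §I.14] -/
theorem _root_.Summit.BirchSwinnertonDyer.Rank1Residual.AdditivePotMult.ClassX3M.missingLowerBoundAt_rankZero_of_ratCharEqMult_of_unitCoeff
    (hDelX : Delbourgo1998.prop4_rankZero_constantCoeff_eq_unit_mul_of_potMult)
    (hPal : Pal2012.thm32_sqrt_mul_realPeriodRat_twist_eq_of_prime_one_mod_four)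
    (hGZK : rank_eq_analyticRank_of_analyticRank_le_one) (hmod : hasEntireLFunction_rat)
    (hmodD : nonempty_modularParametrizationData)
    (hX : AdditivePotMult.ClassX3M W p) (hp4 : p % 4 = 1) (hr : W.analyticRank = 0)
    (hMC : ChiBranchRatCharEqMultAt W p) (hcert : MultBranchUnitCoeffCert W p) :
    MissingLowerBoundAt W p := by
  obtain ⟨V, iV, iVm, C, hV, hC⟩ := hX.exists_mult_pStar_twist_model
  haveI : NeZero (V.conductorNorm ℤ) := ⟨(V.conductorNorm_pos_holds).ne'⟩
  obtain ⟨Dm⟩ := hmodD V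
  obtain ⟨ϖ, -, hϖ, -⟩ := Dm.exists_rat_mul_realPeriodRat_eq_plusPeriod
  have hC' : C • V.quadraticTwist (p : ℚ) = W := by
    rw [pStar_eq_of_mod_four p (Or.inl hp4), if_pos hp4] at hC
    exact hC
  have hLow : CycLowerLeadingTermAt W p := by
    by_cases hs : V.HasSplitMultiplicativeReductionAtPrime p
    · obtain ⟨hap, -⟩ := Dm.isNewformOf.cuspCoeff_eq_one_and_sq_of_split hs
      have hap' : cuspCoeff Dm.f p = ((1 : ℤ) : ℂ) := by exact_mod_cast hap
      exact cycLowerLeadingTermAt_of_chiBranchRatCharEqMult_of_unitCoeff W p hPal hmod hp4 hX.2.1.1 V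
        ⟨C, hC'⟩ hV Dm.isNewformOf (Dm.isNewformOf.dvd_level_of_split hs) hap' (Or.inl rfl) ϖ hϖ hMC
        (hcert V C hV hC' Dm.f Dm.isNewformOf 1 hap' ϖ hϖ)
    · obtain ⟨hap, hpN⟩ := Dm.isNewformOf.cuspCoeff_eq_neg_one_and_dvd_of_nonsplit hV hs
      have hap' : cuspCoeff Dm.f p = ((-1 : ℤ) : ℂ) := by exact_mod_cast hap
      exact cycLowerLeadingTermAt_of_chiBranchRatCharEqMult_of_unitCoeff W p hPal hmod hp4 hX.2.1.1 V
        ⟨C, hC'⟩ hV Dm.isNewformOf hpN hap' (Or.inr rfl) ϖ hϖ hMC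
        (hcert V C hV hC' Dm.f Dm.isNewformOf (-1) hap' ϖ hϖ)
  exact AdditivePotMult.ClassX3M.missingLowerBoundAt_rankZero_of_cycLeadingTermDvd hDelX hGZK hmod hX hr
    (cycLeadingTermDvdAt_of_cycLowerLeadingTermAt hLow)

/-- **X3♯(M), `p ≡ 3 (mod 4)` (`p = 3` included), `r_an = 0`: the LOWER half from the rational ODD
branch main conjecture of the multiplicative twist and the certificate.**
[cite: Delbourgo1998, Prop. 4 (p. 144), §2.2 Lemma (ii) (p. 139)] [cite: MazurTateTeitelbaum1986Invent, §I.14] -/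
theorem _root_.Summit.BirchSwinnertonDyer.Rank1Residual.AdditivePotMult.ClassX3M.missingLowerBoundAt_rankZero_of_ratCharEqMultOdd_of_unitCoeff
    (hDelX : Delbourgo1998.prop4_rankZero_constantCoeff_eq_unit_mul_of_potMult)
    (hGZK : rank_eq_analyticRank_of_analyticRank_le_one) (hmod : hasEntireLFunction_rat)
    (hmodD : nonempty_modularParametrizationData)
    (hX : AdditivePotMult.ClassX3M W p) (hp4 : p % 4 = 3) (hr : W.analyticRank = 0)
    (hMC : ChiBranchRatCharEqMultOddAt W p) (hcert : MultOddBranchUnitCoeffCert W p) :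
    MissingLowerBoundAt W p := by
  obtain ⟨V, iV, iVm, C, hV, hC⟩ := hX.exists_mult_pStar_twist_model
  haveI : NeZero (V.conductorNorm ℤ) := ⟨(V.conductorNorm_pos_holds).ne'⟩
  obtain ⟨Dm⟩ := hmodD V
  obtain ⟨ϖ, -, hϖ⟩ := exists_rat_mul_imaginaryPeriodRat_eq_minusPeriod Dm
  have hC' : C • V.quadraticTwist (-(p : ℚ)) = W := by
    rw [pStar_eq_of_mod_four p (Or.inr hp4), if_neg (by omega)] at hC
    exact hC
  have hLow : CycLowerLeadingTermAt W p := by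
    by_cases hs : V.HasSplitMultiplicativeReductionAtPrime p
    · obtain ⟨hap, -⟩ := Dm.isNewformOf.cuspCoeff_eq_one_and_sq_of_split hs
      have hap' : cuspCoeff Dm.f p = ((1 : ℤ) : ℂ) := by exact_mod_cast hap
      exact cycLowerLeadingTermAt_of_chiBranchRatCharEqMultOdd_of_unitCoeff W p hmod hp4 hX.2.1.1 V C
        hC' hV Dm.isNewformOf (Dm.isNewformOf.dvd_level_of_split hs) hap' (Or.inl rfl) ϖ hϖ hMC
        (hcert V C hV hC' Dm.f Dm.isNewformOf 1 hap' ϖ hϖ)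
    · obtain ⟨hap, hpN⟩ := Dm.isNewformOf.cuspCoeff_eq_neg_one_and_dvd_of_nonsplit hV hs
      have hap' : cuspCoeff Dm.f p = ((-1 : ℤ) : ℂ) := by exact_mod_cast hap
      exact cycLowerLeadingTermAt_of_chiBranchRatCharEqMultOdd_of_unitCoeff W p hmod hp4 hX.2.1.1 V C
        hC' hV Dm.isNewformOf hpN hap' (Or.inr rfl) ϖ hϖ hMC
        (hcert V C hV hC' Dm.f Dm.isNewformOf (-1) hap' ϖ hϖ)
  exact AdditivePotMult.ClassX3M.missingLowerBoundAt_rankZero_of_cycLeadingTermDvd hDelX hGZK hmod hX hr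
    (cycLeadingTermDvdAt_of_cycLowerLeadingTermAt hLow)

/-- **X3♯(M), `p ≡ 1 (mod 4)`, `r_an = 0`: `BSD(E,p)` from the rational branch main conjecture of the
multiplicative twist + certificate, the upper half being additive-p1's `ClassX3M.bsdp_rankZero_of_lower`
(Wuthrich 2014 Thm. 16 half-eigen `hW16`, Delbourgo 1998 Prop. 4 `hDel`).** Nothing booked.
[cite: Delbourgo1998, Prop. 4 (p. 144)] [cite: Wuthrich2014, Thm. 16 (p. 397)] [cite: Miller2011LMS, Def. 1.1] -/
theorem _root_.Summit.BirchSwinnertonDyer.Rank1Residual.AdditivePotMult.ClassX3M.bsdp_rankZero_of_ratCharEqMult_of_unitCoeff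
    (hDelX : Delbourgo1998.prop4_rankZero_constantCoeff_eq_unit_mul_of_potMult)
    (hDel : Delbourgo1998.prop4_rankZero_pow_dvd_constantCoeff)
    (hPal : Pal2012.thm32_sqrt_mul_realPeriodRat_twist_eq_of_prime_one_mod_four)
    (hGZK : rank_eq_analyticRank_of_analyticRank_le_one) (hmod : hasEntireLFunction_rat)
    (hmodD : nonempty_modularParametrizationData)
    (hW16 : Wuthrich2014.thm16_halfEigenCharIdeal_dvd_cyclotomicPrime)
    (hX : AdditivePotMult.ClassX3M W p) (hp4 : p % 4 = 1) (hr : W.analyticRank = 0)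
    (hMC : ChiBranchRatCharEqMultAt W p) (hcert : MultBranchUnitCoeffCert W p) : BSDp W p :=
  AdditivePotMult.ClassX3M.bsdp_rankZero_of_lower hDel hGZK hmod hmodD hW16 hX hr
    (AdditivePotMult.ClassX3M.missingLowerBoundAt_rankZero_of_ratCharEqMult_of_unitCoeff hDelX hPal
      hGZK hmod hmodD hX hp4 hr hMC hcert)

/-- **X3♯(M), `p ≡ 3 (mod 4)` (`p = 3` included), `r_an = 0`: `BSD(E,p)` from the rational ODD branch
main conjecture of the multiplicative twist + certificate and additive-p1's upper half.** Nothing booked.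
[cite: Delbourgo1998, Prop. 4 (p. 144)] [cite: Wuthrich2014, Thm. 16 (p. 397)] [cite: Miller2011LMS, Def. 1.1] -/
theorem _root_.Summit.BirchSwinnertonDyer.Rank1Residual.AdditivePotMult.ClassX3M.bsdp_rankZero_of_ratCharEqMultOdd_of_unitCoeff
    (hDelX : Delbourgo1998.prop4_rankZero_constantCoeff_eq_unit_mul_of_potMult)
    (hDel : Delbourgo1998.prop4_rankZero_pow_dvd_constantCoeff)
    (hGZK : rank_eq_analyticRank_of_analyticRank_le_one) (hmod : hasEntireLFunction_rat)
    (hmodD : nonempty_modularParametrizationData)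
    (hW16 : Wuthrich2014.thm16_halfEigenCharIdeal_dvd_cyclotomicPrime)
    (hX : AdditivePotMult.ClassX3M W p) (hp4 : p % 4 = 3) (hr : W.analyticRank = 0)
    (hMC : ChiBranchRatCharEqMultOddAt W p) (hcert : MultOddBranchUnitCoeffCert W p) : BSDp W p :=
  AdditivePotMult.ClassX3M.bsdp_rankZero_of_lower hDel hGZK hmod hmodD hW16 hX hr
    (AdditivePotMult.ClassX3M.missingLowerBoundAt_rankZero_of_ratCharEqMultOdd_of_unitCoeff hDelX
      hGZK hmod hmodD hX hp4 hr hMC hcert)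

end Summit.BirchSwinnertonDyer.Rank1Residual.Additive

end
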